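import Summits.AtomisticToContinuum.FouriersLaw.Theses.PhononMeanFreePath
import Summits.AtomisticToContinuum.FouriersLaw.Theorems.BoundaryKubo.Negative.LoadBearing
import Literature.MathematicalPhysics.KineticTheory.LangevinChainLocalMinorization

/-!
# Uniform stochastic continuity of the pinned chain at the equilibrium
(stub `stub_uniformBallGeHalf` of line `gibbs-ttcf`, crux stmt-AtomisticToContinuum-11812
`PhononMeanFreePath.BoundaryKubo`)

For the pinned chain `P = pinnedChain ω₂ lam β γ` with `N + 1` sites and every `ε₁ > 0` there is a short
time `η > 0`, UNIFORM for bath temperatures `0 < a, b ≤ Thi`, such that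
`K^{a,b}_s(w, B(0, ε₁)) ≥ 1/2` for all `s ≤ η` and all `‖w‖ < ε₁ / 2`
(`K = OscillatorChain.transitionKernel`, the CONSTRUCTED kernels of `LangevinChainKernel.lean`).

Proof: the tree proof of `pinnedChain_transitionKernel_ball_ge_half`
(`LangevinChainLocalMinorization.lean`) verbatim — the undriven flow moves by `O(s)` on an energy
sublevel set, the driven flow is uniformly close to it when the Brownian pair is small on `[0, s]`
(`pinnedChain_exists_norm_chainFlow_sub_lt`), and the latter has probability `≥ 1/2` for short `s`
(`measure_compl_goodEvent_le`) — with the only temperature-dependent constant, the sum of the noise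
amplitudes `|√(2γT_L)| + |√(2γT_R)|` in the size of the good event, replaced by its upper bound
`2 √(2γ Thi)` (`Real.sqrt_le_sqrt`). The general-`N`, `T_b ≤ Thi` version is
`pinnedChain_transitionKernel_ball_ge_half_unif`; the registered stub is its specialisation.
-/

noncomputable section

open scoped NNReal ENNReal Topology
open MeasureTheory Filter Set

namespace Summit.AtomisticToContinuum.FouriersLaw.Theorems.BoundaryKubo.GibbsTtcf

open Literature.MathematicalPhysics.KineticTheory.HeatConduction
open Literature.MathematicalPhysics.KineticTheory Literature.Probability.Process OscillatorChain
open ProbabilityTheory Metric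
open Summit.AtomisticToContinuum.FouriersLaw.Theorems.BoundaryKubo.Negative.LoadBearing
  (kuboIntegrand kuboValue LimitClause UniqueSteady SteadyFamily boundaryKubo_iff)

/-- **Uniform stochastic continuity at the equilibrium, uniformly in bounded bath temperatures**:
for every `ε₁ > 0` and every temperature cap `Thi` there is `δ > 0` such that
`P^{T_L,T_R}_s(w, B(0, ε₁)) ≥ 1/2` for all `T_L, T_R ≤ Thi`, all `s ≤ δ` and all `‖w‖ < ε₁/2`
(the undriven flow moves by `O(s)` on a sublevel set of the energy, the driven flow is uniformly
close to it when the Brownian pair is small on `[0, s]`, and the latter happens with probability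
`≥ 1/2` for short `s` by the Doob bound of `BrownianSupTail.lean`; the noise amplitudes
`√(2γT_b) ≤ √(2γ Thi)` enter only the size of the good event). [folklore]
-- adapted from `pinnedChain_transitionKernel_ball_ge_half` (LangevinChainLocalMinorization.lean) -/
theorem pinnedChain_transitionKernel_ball_ge_half_unif {ω₂ lam β γ : ℝ} (hω : 0 < ω₂) (hl : 0 ≤ lam)
    (hβ : 0 ≤ β) (hγ : 0 ≤ γ) (N : ℕ) (Thi : ℝ) {ε₁ : ℝ} (hε₁ : 0 < ε₁) :
    ∃ δ : ℝ, 0 < δ ∧ ∀ T_L T_R : ℝ, T_L ≤ Thi → T_R ≤ Thi → ∀ s : ℝ≥0, (s : ℝ) ≤ δ →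
      ∀ w : PhaseSpace N, ‖w‖ < ε₁ / 2 →
        2⁻¹ ≤ (pinnedChain ω₂ lam β γ).transitionKernel N T_L T_R s w (ball 0 ε₁) := by
  set P := pinnedChain ω₂ lam β γ with hP
  -- the uniform cap on the noise amplitudes
  set cM : ℝ := Real.sqrt (2 * γ * Thi) with hcM
  have hcM0 : 0 ≤ cM := Real.sqrt_nonneg _
  -- energy bound on the ball and a bound of the drift on the sublevel set
  obtain ⟨E₀, hE₀⟩ := (isCompact_closedBall (0 : PhaseSpace N) ε₁).exists_bound_of_continuousOn
    ((pinnedChain_continuous_hamiltonian ω₂ lam β γ N).continuousOn)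
  have hE₀' : ∀ w : PhaseSpace N, ‖w‖ ≤ ε₁ → P.hamiltonian N w ≤ E₀ := fun w hw =>
    (Real.le_norm_self _).trans (hE₀ w (by simpa using hw))
  obtain ⟨CY, hCY⟩ := (pinnedChain_isCompact_setOf_hamiltonian_le hω hl hβ γ N E₀).exists_bound_of_continuousOn
    ((pinnedChain_contDiff_drift ω₂ lam β γ N (n := 0)).continuous.continuousOn)
  have hCY0 : 0 ≤ CY := by
    have h0 : (0 : PhaseSpace N) ∈ {x : PhaseSpace N | P.hamiltonian N x ≤ E₀} :=
      hE₀' 0 (by simp [hε₁.le])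
    exact (norm_nonneg _).trans (hCY 0 h0)
  -- continuity in the noise
  obtain ⟨δ₁, hδ₁, hnoise⟩ := pinnedChain_exists_norm_chainFlow_sub_lt hω hl hβ hγ N E₀ 1 1
    (show (0 : ℝ) < ε₁ / 4 by positivity)
  -- the noise amplitude on the good event (uniform for amplitudes `≤ cM`)
  set a : ℝ := min δ₁ 1 / (2 * cM + 1) with ha
  have hapos : 0 < a := by positivity
  have habound : (2 * cM) * a ≤ min δ₁ 1 := by
    rw [ha, mul_div_assoc', div_le_iff₀ (by positivity)]
    have : 0 ≤ min δ₁ 1 := by positivity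
    nlinarith
  -- the time scale
  set δ : ℝ := min (a ^ 2 / 4) (min 1 (ε₁ / (4 * (CY + 1)))) with hδ
  have hδpos : 0 < δ := by positivity
  refine ⟨δ, hδpos, fun T_L T_R hTL hTR s hs w hw => ?_⟩
  -- the actual noise amplitudes, bounded by the cap
  set cL : ℝ := Real.sqrt (2 * γ * T_L) with hcL
  set cR : ℝ := Real.sqrt (2 * γ * T_R) with hcR
  have hcLM : |cL| ≤ cM := by
    rw [abs_of_nonneg (Real.sqrt_nonneg _)]
    exact Real.sqrt_le_sqrt (mul_le_mul_of_nonneg_left hTL (by positivity))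
  have hcRM : |cR| ≤ cM := by
    rw [abs_of_nonneg (Real.sqrt_nonneg _)]
    exact Real.sqrt_le_sqrt (mul_le_mul_of_nonneg_left hTR (by positivity))
  have habound' : (|cL| + |cR|) * a ≤ min δ₁ 1 :=
    (mul_le_mul_of_nonneg_right (by linarith) hapos.le).trans habound
  have hs1 : (s : ℝ) ≤ 1 := hs.trans ((min_le_right _ _).trans (min_le_left _ _))
  have hsa : (s : ℝ) ≤ a ^ 2 / 4 := hs.trans (min_le_left _ _)
  have hsε : (s : ℝ) ≤ ε₁ / (4 * (CY + 1)) := hs.trans ((min_le_right _ _).trans (min_le_right _ _))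
  have hwE : P.hamiltonian N w ≤ E₀ := hE₀' w (by linarith [norm_nonneg w])
  -- on the good event the solution is in the ball
  have hsub : goodEvent a s ⊆ (fun ω => P.solMap N T_L T_R s w (pairPath ω)) ⁻¹' ball 0 ε₁ := by
    intro ω hωg
    rw [mem_preimage, mem_ball, dist_zero_right]
    set ηω : ℝ → Fin N → ℝ := chainNoise N cL cR (pairPath ω) with hηω
    have hηc : Continuous ηω := continuous_chainNoise cL cR (pairPath ω)
    have hηsmall : ∀ t ∈ Icc (0 : ℝ) s, ‖ηω t‖ ≤ min δ₁ 1 := by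
      intro t ht
      obtain ⟨h1, h2⟩ := abs_brownian_toNNReal_le_of_mem_goodEvent hωg ht.2
      refine (norm_chainNoise_pairPath_le cL cR ω t).trans (le_trans ?_ habound')
      have hcL0 : 0 ≤ |cL| := abs_nonneg _
      have hcR0 : 0 ≤ |cR| := abs_nonneg _
      nlinarith [mul_le_mul_of_nonneg_left h1 hcL0, mul_le_mul_of_nonneg_left h2 hcR0]
    -- the stopped noise `t ↦ ηω (min t s)` is bounded by `min δ₁ 1` on `[0, 1]` and agrees with
    -- `ηω` on `[0, s]`
    set ηs : ℝ → Fin N → ℝ := fun t => ηω (min t s) with hηs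
    have hηsc : Continuous ηs := hηc.comp (continuous_id.min continuous_const)
    have hηs_bound : ∀ t ∈ Icc (0 : ℝ) 1, ‖ηs t‖ ≤ min δ₁ 1 := fun t ht =>
      hηsmall (min t s) ⟨le_min ht.1 s.coe_nonneg, min_le_right _ _⟩
    have hflow_s : P.chainFlow N w ηω s = P.chainFlow N w ηs s :=
      pinnedChain_chainFlow_congr hω hl hβ hγ N w hηc hηsc (T := s)
        (fun t ht => by simp [hηs, min_eq_left ht.2]) ⟨s.coe_nonneg, le_rfl⟩
    have h1 : ‖P.chainFlow N w ηs s - P.chainFlow N w 0 s‖ < ε₁ / 4 :=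
      hnoise w hwE ηs 0 hηsc continuous_zero
        (fun t ht => (hηs_bound t ht).trans (min_le_right _ _)) (fun t _ => by simp)
        (fun t ht => by simpa using (hηs_bound t ht).trans (min_le_left _ _)) s ⟨s.coe_nonneg, hs1⟩
    -- the undriven flow moves by at most `s CY`
    have h2 : ‖P.chainFlow N w 0 s - w‖ ≤ s * CY := by
      rw [pinnedChain_freeFlow_eq_integral hω hl hβ hγ N w s.coe_nonneg, add_sub_cancel_left]
      have hb : ∀ u ∈ Set.uIoc (0 : ℝ) s, ‖P.drift N (P.chainFlow N w 0 u)‖ ≤ CY := by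
        intro u _
        refine hCY _ ?_
        exact (pinnedChain_freeFlow_mem_sublevel hω hl hβ hγ N w u).trans hwE
      have := intervalIntegral.norm_integral_le_of_norm_le_const hb
      rwa [sub_zero, abs_of_nonneg s.coe_nonneg, mul_comm] at this
    have h2' : (s : ℝ) * CY < ε₁ / 4 := by
      calc (s : ℝ) * CY ≤ ε₁ / (4 * (CY + 1)) * CY := mul_le_mul_of_nonneg_right hsε hCY0
        _ < ε₁ / 4 := by
            rw [div_mul_eq_mul_div, div_lt_div_iff₀ (by positivity) (by positivity)]
            nlinarith
    have hsol : P.solMap N T_L T_R s w (pairPath ω) = P.chainFlow N w ηω s := rfl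
    rw [hsol, hflow_s]
    calc ‖P.chainFlow N w ηs s‖ = ‖(P.chainFlow N w ηs s - P.chainFlow N w 0 s) +
          (P.chainFlow N w 0 s - w) + w‖ := by congr 1; abel
      _ ≤ ‖P.chainFlow N w ηs s - P.chainFlow N w 0 s‖ + ‖P.chainFlow N w 0 s - w‖ + ‖w‖ := norm_add₃_le
      _ < ε₁ / 4 + ε₁ / 4 + ε₁ / 2 := by linarith
      _ = ε₁ := by ring
  -- probability of the good event
  have hgood : 2⁻¹ ≤ wienerPair (goodEvent a s) := by
    have hsa' : (s : ℝ) < a ^ 2 := by nlinarith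
    have hcompl := measure_compl_goodEvent_le hapos.le s hsa'
    have hbound : 2 * ENNReal.ofReal (2 * (s : ℝ) ^ 2 / (a ^ 2 - s) ^ 2) ≤ 2⁻¹ := by
      have hden : 3 * a ^ 2 / 4 ≤ a ^ 2 - s := by nlinarith
      have hden0 : 0 < 3 * a ^ 2 / 4 := by positivity
      have hs0 : (0 : ℝ) ≤ s := s.coe_nonneg
      have hreal : 2 * (s : ℝ) ^ 2 / (a ^ 2 - s) ^ 2 ≤ 2 / 9 := by
        rw [div_le_div_iff₀ (by positivity) (by norm_num)]
        have h1 : (s : ℝ) ^ 2 ≤ (a ^ 2 / 4) ^ 2 := pow_le_pow_left₀ hs0 hsa 2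
        have h2 : (3 * a ^ 2 / 4) ^ 2 ≤ (a ^ 2 - s) ^ 2 := pow_le_pow_left₀ hden0.le hden 2
        nlinarith
      calc 2 * ENNReal.ofReal (2 * (s : ℝ) ^ 2 / (a ^ 2 - s) ^ 2) ≤ 2 * ENNReal.ofReal (2 / 9) := by
            gcongr
        _ = ENNReal.ofReal (4 / 9) := by
            rw [← ENNReal.ofReal_ofNat, ← ENNReal.ofReal_mul (by norm_num)]; norm_num
        _ ≤ ENNReal.ofReal (1 / 2) := ENNReal.ofReal_le_ofReal (by norm_num)
        _ = 2⁻¹ := by rw [one_div, ENNReal.ofReal_inv_of_pos two_pos, ENNReal.ofReal_ofNat]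
    have hprob : wienerPair (goodEvent a s) = 1 - wienerPair (goodEvent a s)ᶜ := by
      rw [prob_compl_eq_one_sub (measurableSet_goodEvent a s), ENNReal.sub_sub_cancel ENNReal.one_ne_top prob_le_one]
    rw [hprob]
    have h3 : wienerPair (goodEvent a s)ᶜ ≤ 2⁻¹ := hcompl.trans hbound
    calc (2⁻¹ : ℝ≥0∞) = 1 - 2⁻¹ := by norm_num [ENNReal.one_sub_inv_two]
      _ ≤ 1 - wienerPair (goodEvent a s)ᶜ := tsub_le_tsub_left h3 1
  rw [pinnedChain_transitionKernel_apply' hω hl hβ hγ N T_L T_R s w measurableSet_ball]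
  exact hgood.trans (measure_mono hsub)

/-- STUB 1a-ii `stub_uniformBallGeHalf` of line `gibbs-ttcf`: uniform stochastic continuity at the
equilibrium (`pinnedChain_transitionKernel_ball_ge_half`) with the short time `η` UNIFORM for bath
temperatures in `(0, Thi]`: for the pinned chain with `N + 1` sites and every `ε₁ > 0` there is `η > 0`
with `K^{a,b}_s(w, B(0, ε₁)) ≥ 1/2` for all `0 < a, b ≤ Thi`, `s ≤ η`, `‖w‖ < ε₁ / 2` (the noise on `[0, s]`
is `(c_L B¹, c_R B²)` with `c_b = √(2γ T_b) ≤ √(2γ Thi)`; specialisation of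
`pinnedChain_transitionKernel_ball_ge_half_unif`). [folklore] -/
theorem stub_uniformBallGeHalf :
    ∀ ω₂ lam β γ : ℝ, 0 < ω₂ → 0 < lam → 0 < β → 0 < γ → ∀ (N : ℕ) (Thi : ℝ), 0 < Thi →
      ∀ ε₁ : ℝ, 0 < ε₁ → ∃ η : ℝ, 0 < η ∧ ∀ a b : ℝ, 0 < a → a ≤ Thi → 0 < b → b ≤ Thi →
        ∀ s : ℝ≥0, (s : ℝ) ≤ η → ∀ w : PhaseSpace (N + 1), ‖w‖ < ε₁ / 2 →
          2⁻¹ ≤ (pinnedChain ω₂ lam β γ).transitionKernel (N + 1) a b s w (Metric.ball 0 ε₁) := by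
  intro ω₂ lam β γ hω hl hβ hγ N Thi _ ε₁ hε₁
  obtain ⟨δ, hδ, h⟩ :=
    pinnedChain_transitionKernel_ball_ge_half_unif hω hl.le hβ.le hγ.le (N + 1) Thi hε₁
  exact ⟨δ, hδ, fun a b _ ha _ hb s hs w hw => h a b ha hb s hs w hw⟩

end Summit.AtomisticToContinuum.FouriersLaw.Theorems.BoundaryKubo.GibbsTtcf

end
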